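import Literature.Probability.LatticeModels.KCSectionFamilyLimits
import Literature.Probability.LatticeModels.KCMeshShadow
import HarnessLib

/-!
# Families of spin-fermion data with background spins, III: the maximum principle for `Hb` near a background spin

Topic `Literature/Probability/LatticeModels`. Chelkak–Hongler–Izyurov 2015, proof of Thm 2.16
(§3.4), property (3) of Prop. 3.9: "By superharmonicity of `H•`, we have
`min_{|z-a_j|<2ε} H_δ(z) = min_{ε<|z-a_j|<2ε} H•_δ(z)`, thus `h̃` is bounded from below in the
neighborhoods of `a_j`." In the tree's orientation `(Hw, Hb) = -(H°, H•)` this is the maximum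
principle for the plaquette primitive `Hb`, which is SUBharmonic at every plaquette all of whose
sides touch the free sites and which carries an odd number of cut bonds
(`IsKCPrimitive.latticeLaplacian_black_nonneg`) — in particular at every plaquette near a
background spin `b̂ ∈ B` (only the source plaquette is even), although `Hw` is not superharmonic at
`b̂` itself. For a family `𝓕 : KCSectionFamily` (`KCSectionFamily.lean`):

* `IsPlaqBulkOn 𝓕 Ω c r` — on the closed disc of radius `r` about `c`, eventually along the mesh,
  every site is free with its four plaquettes in the plaquette set, the four sides of its plaquette
  touching the volume and an odd number of them cut (the `bulk` clauses of `IsNiceCore` except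
  `y ∉ B`, which fails at a background spin);
* `IsPlaqBulkOn.subharmonicOn` — then `Hb δ` is lattice-subharmonic on the sites with mesh point
  in the disc of radius `r - 2δ`;
* **`IsPlaqBulkOn.hb_le_near`** — the maximum principle on a lattice ball: a bound `Hb δ ≤ M δ` on
  the annulus `r/8 ≤ |· - c| ≤ r` propagates to `Hb δ ≤ M δ` and `Hw δ ≤ M δ` on the disc
  `|· - c| < r/8` (`IsLatticeSubharmonicOn.le_of_forall_boundary_le`, `IsKCPrimitive.hw_le_hb`);
* **`IsPlaqBulkOn.hlim_le_near`** — hence a pointwise limit `hlim` of the normalised primitives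
  `HwN N = Hw/N` is bounded above on the punctured disc `0 < |z - c| < r/16` by the constant of the
  annulus bound `Hb ≤ M · N`: hypothesis `h3` of `eqOn_domainSpinorSq_of_bvp` for `h = -hlim`.

Everything is proved; no named fact.

## References

* D. Chelkak, C. Hongler, K. Izyurov, Ann. of Math. 181 (2015), Prop. 3.6, Remark 3.7, §3.4
  [ChelkakHonglerIzyurovAnnals2015].
-/

noncomputable section

namespace Literature.Probability.LatticeModels

open Filter _root_.Topology Metric Set Finset Complex SimpleGraph

/-! ### Lattice balls and Euclidean distances -/

/-- A site outside the lattice ball of radius `R` about `x` has its mesh point at distance at least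
`δ (R + 1)` from that of `x`. [folklore] -/
theorem le_dist_meshPoint_of_not_mem_latticeBall {δ : ℝ} (hδ : 0 ≤ δ) {x w : Site 2} {R : ℤ}
    (hw : w ∉ latticeBall x R) : δ * ((R : ℝ) + 1) ≤ dist (meshPoint δ w) (meshPoint δ x) := by
  rw [mem_latticeBall] at hw
  push Not at hw
  obtain ⟨i, hi⟩ := hw
  have hcoord : (R : ℝ) + 1 ≤ |((w i : ℤ) : ℝ) - x i| := by
    have : R + 1 ≤ |w i - x i| := by
      rw [le_abs]
      by_cases h : x i - R ≤ w i
      · left; have := hi h; omega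
      · right; push Not at h; omega
    exact_mod_cast this
  rw [Complex.dist_eq]
  have h0 : |δ * ((w 0 : ℝ) - x 0)| ≤ ‖meshPoint δ w - meshPoint δ x‖ := by
    have h := Complex.abs_re_le_norm (meshPoint δ w - meshPoint δ x)
    simp only [Complex.sub_re, meshPoint_re] at h
    rwa [← mul_sub] at h
  have h1 : |δ * ((w 1 : ℝ) - x 1)| ≤ ‖meshPoint δ w - meshPoint δ x‖ := by
    have h := Complex.abs_im_le_norm (meshPoint δ w - meshPoint δ x)
    simp only [Complex.sub_im, meshPoint_im] at h
    rwa [← mul_sub] at h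
  have key : |δ * ((w i : ℝ) - x i)| ≤ ‖meshPoint δ w - meshPoint δ x‖ := by
    fin_cases i
    · exact h0
    · exact h1
  rw [abs_mul, abs_of_nonneg hδ] at key
  calc δ * ((R : ℝ) + 1) ≤ δ * |((w i : ℤ) : ℝ) - x i| := by gcongr
    _ ≤ _ := key

/-- A site whose mesh point is within `δ R` of that of `x` lies in the lattice ball of radius `R`. [folklore] -/
theorem mem_latticeBall_of_dist_le {δ : ℝ} (hδ : 0 < δ) {x y : Site 2} {R : ℤ}
    (h : dist (meshPoint δ y) (meshPoint δ x) ≤ δ * R) : y ∈ latticeBall x R := by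
  by_contra hy
  have := le_dist_meshPoint_of_not_mem_latticeBall hδ.le hy
  have : δ * ((R : ℝ) + 1) ≤ δ * R := this.trans h
  nlinarith

/-- Neighbouring sites have `2δ`-close mesh points. [folklore] -/
theorem dist_meshPoint_add_cornerUnit_le {δ : ℝ} (hδ : 0 ≤ δ) (y : Site 2) (k : Fin 4) :
    dist (meshPoint δ (y + cornerUnit k)) (meshPoint δ y) ≤ 2 * δ := by
  have h := dist_meshPoint_le_abs_add_abs δ (y + cornerUnit k) (meshPoint δ y)
  simp only [meshPoint_re, meshPoint_im, Pi.add_apply, Int.cast_add] at h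
  rw [show δ * ((y 0 : ℝ) + (cornerUnit k 0 : ℤ)) - δ * y 0 = δ * (cornerUnit k 0 : ℤ) by ring,
    show δ * ((y 1 : ℝ) + (cornerUnit k 1 : ℤ)) - δ * y 1 = δ * (cornerUnit k 1 : ℤ) by ring,
    abs_mul, abs_mul, abs_of_nonneg hδ] at h
  have h0 : |((cornerUnit k 0 : ℤ) : ℝ)| ≤ 1 := by fin_cases k <;> simp
  have h1 : |((cornerUnit k 1 : ℤ) : ℝ)| ≤ 1 := by fin_cases k <;> simp
  calc dist (meshPoint δ (y + cornerUnit k)) (meshPoint δ y) ≤ δ * |((cornerUnit k 0 : ℤ) : ℝ)| + δ * |((cornerUnit k 1 : ℤ) : ℝ)| := h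
    _ ≤ δ * 1 + δ * 1 := by gcongr
    _ = 2 * δ := by ring

namespace KCSectionFamily

variable (𝓕 : KCSectionFamily) (Ω : Set ℂ)

/-- **The plaquette-bulk clauses on a closed disc**: eventually along the mesh, every site with mesh
point in the closed disc of radius `r` about `c` is free, its four plaquettes lie in the plaquette
set, the four sides of its own plaquette touch the volume and an odd number of them is cut. (Near a
background spin these hold although the site clause `y ∉ B` of the bulk fails.) [cite: ChelkakHonglerIzyurovAnnals2015, §3.3] -/
def IsPlaqBulkOn (c : ℂ) (r : ℝ) : Prop :=
  ∀ᶠ δ in 𝓝[>] (0 : ℝ), ∀ y : Site 2, dist (meshPoint δ y) c ≤ r →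
    y ∈ 𝓕.Λ δ ∧ (∀ k : Fin 4, faceAt y k ∈ 𝓕.P δ) ∧
    (∀ j : Fin 4, s(y + cornerOff j, y + cornerOff j + cornerUnit j) ∈ edgesTouching (discreteDomainGraph Ω δ) (𝓕.Λ δ)) ∧
    Odd #(Finset.univ.filter fun j : Fin 4 => s(y + cornerOff j, y + cornerOff j + cornerUnit j) ∈ 𝓕.cut δ y)

variable {𝓕 Ω} {c : ℂ} {r : ℝ} {N : ℝ → ℝ}

/-- **`Hb` is subharmonic on the disc** (radius `r - 2δ`). [cite: ChelkakHonglerIzyurovAnnals2015, Prop. 3.6] -/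
theorem IsPlaqBulkOn.subharmonicOn (hB : 𝓕.IsPlaqBulkOn Ω c r)
    (hcuts : ∀ᶠ δ in 𝓝[>] (0 : ℝ), IsKCCuts (discreteDomainGraph Ω δ) (𝓕.Λ δ) (𝓕.cut δ) (𝓕.P δ))
    (hprim : ∀ᶠ δ in 𝓝[>] (0 : ℝ),
      IsKCPrimitive (discreteDomainGraph Ω δ) (𝓕.Λ δ) criticalBetaTwo (.fixed 1) (𝓕.B δ) (𝓕.cut δ) (𝓕.Hw δ) (𝓕.Hb δ) (𝓕.P δ)) :
    ∀ᶠ δ in 𝓝[>] (0 : ℝ), IsLatticeSubharmonicOn (𝓕.Hb δ) {f | dist (meshPoint δ f) c ≤ r - 2 * δ} := by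
  filter_upwards [hB, hcuts, hprim, self_mem_nhdsWithin] with δ hB hc hp hδ0
  intro f hf
  have hδ0 : (0 : ℝ) < δ := hδ0
  have hf' : dist (meshPoint δ f) c ≤ r := hf.trans (by simp only [Set.mem_setOf_eq] at hf ⊢; linarith)
  have hnb : ∀ m : Fin 4, dist (meshPoint δ (f + cornerUnit m)) c ≤ r := fun m =>
    calc dist (meshPoint δ (f + cornerUnit m)) c ≤ dist (meshPoint δ (f + cornerUnit m)) (meshPoint δ f) + dist (meshPoint δ f) c :=
          dist_triangle _ _ _
      _ ≤ 2 * δ + (r - 2 * δ) := add_le_add (dist_meshPoint_add_cornerUnit_le hδ0.le f m) hf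
      _ = r := by ring
  obtain ⟨-, hfaces, hsides, hodd⟩ := hB f hf'
  refine hp.latticeLaplacian_black_nonneg hc ?_ (fun j => ?_) hsides hodd
  · simpa [faceAt_zero_eq] using hfaces 0
  · simpa [faceAt_zero_eq] using (hB _ (hnb (j + 3))).2.1 0

/-- **The maximum principle for `Hb` on a disc**: a bound `Hb δ ≤ M δ` on the annulus
`r/8 ≤ |· - c| ≤ r` gives `Hb δ ≤ M δ` and `Hw δ ≤ M δ` on the disc `|· - c| < r/8`, for all
small `δ`. [cite: ChelkakHonglerIzyurovAnnals2015, Remark 3.7 and §3.4 (property (3))] -/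
theorem IsPlaqBulkOn.hb_le_near (hB : 𝓕.IsPlaqBulkOn Ω c r) (hr : 0 < r)
    (hcuts : ∀ᶠ δ in 𝓝[>] (0 : ℝ), IsKCCuts (discreteDomainGraph Ω δ) (𝓕.Λ δ) (𝓕.cut δ) (𝓕.P δ))
    (hprim : ∀ᶠ δ in 𝓝[>] (0 : ℝ),
      IsKCPrimitive (discreteDomainGraph Ω δ) (𝓕.Λ δ) criticalBetaTwo (.fixed 1) (𝓕.B δ) (𝓕.cut δ) (𝓕.Hw δ) (𝓕.Hb δ) (𝓕.P δ))
    {M : ℝ → ℝ}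
    (hM : ∀ᶠ δ in 𝓝[>] (0 : ℝ), ∀ y : Site 2, r / 8 ≤ dist (meshPoint δ y) c → dist (meshPoint δ y) c ≤ r → 𝓕.Hb δ y ≤ M δ) :
    ∀ᶠ δ in 𝓝[>] (0 : ℝ), ∀ y : Site 2, dist (meshPoint δ y) c < r / 8 → 𝓕.Hb δ y ≤ M δ ∧ 𝓕.Hw δ y ≤ M δ := by
  have hδev : ∀ᶠ δ in 𝓝[>] (0 : ℝ), δ < r / 16 := mem_nhdsWithin_of_mem_nhds (Iio_mem_nhds (by positivity))
  filter_upwards [hB, hB.subharmonicOn hcuts hprim, hprim, hM, hδev, self_mem_nhdsWithin] with δ hB hsub hp hM hδ hδ0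
  intro y hy
  have hδ0 : (0 : ℝ) < δ := hδ0
  -- the lattice ball `S` of radius `R = ⌊r/(4δ)⌋` about the nearest site of `c`
  obtain ⟨x₀, hx₀⟩ : ∃ x₀ : Site 2, x₀ = nearestSite δ c := ⟨_, rfl⟩
  obtain ⟨R, hRdef⟩ : ∃ R : ℤ, R = ⌊r / (4 * δ)⌋ := ⟨_, rfl⟩
  have hx₀c : dist (meshPoint δ x₀) c ≤ δ := hx₀ ▸ dist_meshPoint_nearestSite_le hδ0 c
  have hRle : (R : ℝ) ≤ r / (4 * δ) := hRdef ▸ Int.floor_le _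
  have hRlt : r / (4 * δ) < (R : ℝ) + 1 := hRdef ▸ Int.lt_floor_add_one _
  have hRδ : δ * R ≤ r / 4 := by
    calc δ * (R : ℝ) ≤ δ * (r / (4 * δ)) := by gcongr
      _ = r / 4 := by field_simp
  have hRδ' : r / 4 < δ * ((R : ℝ) + 1) := by
    calc r / 4 = δ * (r / (4 * δ)) := by field_simp
      _ < δ * ((R : ℝ) + 1) := by gcongr
  obtain ⟨S, hS⟩ : ∃ S : Set (Site 2), S = ↑(latticeBall x₀ R) := ⟨_, rfl⟩
  have hSfin : S.Finite := hS ▸ Finset.finite_toSet _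
  -- distances: points of `S` are within `r/2 + δ` of `c`, boundary points at least `r/4 - δ` away
  have hSdist : ∀ v ∈ S, dist (meshPoint δ v) c ≤ r / 2 + δ := fun v hv => by
    rw [hS] at hv
    calc dist (meshPoint δ v) c ≤ dist (meshPoint δ v) (meshPoint δ x₀) + dist (meshPoint δ x₀) c := dist_triangle _ _ _
      _ ≤ δ * (2 * R) + δ := add_le_add (KCFamily.dist_meshPoint_le_of_mem_latticeBall hδ0.le hv) hx₀c
      _ ≤ r / 2 + δ := by linarith
  have hSsub : IsLatticeSubharmonicOn (𝓕.Hb δ) S := fun v hv => hsub v (by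
    show dist (meshPoint δ v) c ≤ r - 2 * δ
    linarith [hSdist v hv])
  have hbdry : ∀ w ∈ latticeOuterBoundary S, 𝓕.Hb δ w ≤ M δ := by
    rintro w ⟨hwS, v, hv, k, rfl⟩
    have h1 : δ * ((R : ℝ) + 1) ≤ dist (meshPoint δ (v + cornerUnit k)) (meshPoint δ x₀) :=
      le_dist_meshPoint_of_not_mem_latticeBall hδ0.le (by rwa [hS] at hwS)
    have h2 : dist (meshPoint δ (v + cornerUnit k)) c ≤ r / 2 + δ + 2 * δ :=
      calc dist (meshPoint δ (v + cornerUnit k)) c ≤ dist (meshPoint δ (v + cornerUnit k)) (meshPoint δ v) + dist (meshPoint δ v) c :=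
            dist_triangle _ _ _
        _ ≤ 2 * δ + (r / 2 + δ) := add_le_add (dist_meshPoint_add_cornerUnit_le hδ0.le v k) (hSdist v hv)
        _ = r / 2 + δ + 2 * δ := by ring
    have h3 : dist (meshPoint δ (v + cornerUnit k)) (meshPoint δ x₀) ≤ dist (meshPoint δ (v + cornerUnit k)) c + dist (meshPoint δ x₀) c := by
      rw [← dist_comm c (meshPoint δ x₀)]; exact dist_triangle _ _ _
    refine hM _ ?_ ?_ <;> linarith
  have hmax := hSsub.le_of_forall_boundary_le hSfin hbdry
  -- the site `y` lies in `S`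
  have hyS : y ∈ S := by
    rw [hS]
    refine Finset.mem_coe.2 (mem_latticeBall_of_dist_le hδ0 ?_)
    calc dist (meshPoint δ y) (meshPoint δ x₀) ≤ dist (meshPoint δ y) c + dist (meshPoint δ x₀) c := by
          rw [← dist_comm c (meshPoint δ x₀)]; exact dist_triangle _ _ _
      _ ≤ r / 8 + δ := add_le_add hy.le hx₀c
      _ ≤ δ * R := by nlinarith
  have hyb := hmax y hyS
  refine ⟨hyb, ?_⟩
  have hface : faceAt y 0 ∈ 𝓕.P δ := (hB y (by linarith [hy.le])).2.1 0
  calc 𝓕.Hw δ y ≤ 𝓕.Hb δ (faceAt y 0) := hp.hw_le_hb _ hface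
    _ = 𝓕.Hb δ y := by rw [faceAt_zero_eq]
    _ ≤ M δ := hyb

/-- **Property (3) of the limit: a pointwise limit of `Hw/N` is bounded above near a background
spin.** If `Hb δ ≤ M · N δ` on the annulus `r/8 ≤ |· - c| ≤ r` for small `δ`, then any pointwise
limit `hlim` of `HwN N (s k) (nearestSite (s k) z)` along `s k → 0⁺` satisfies `hlim z ≤ M` for
`0 < |z - c| < r/16` — hypothesis `h3` of `eqOn_domainSpinorSq_of_bvp` for `h = -hlim`. [cite: ChelkakHonglerIzyurovAnnals2015, §3.4 (property (3))] -/
theorem IsPlaqBulkOn.hlim_le_near (hB : 𝓕.IsPlaqBulkOn Ω c r) (hr : 0 < r)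
    (hcuts : ∀ᶠ δ in 𝓝[>] (0 : ℝ), IsKCCuts (discreteDomainGraph Ω δ) (𝓕.Λ δ) (𝓕.cut δ) (𝓕.P δ))
    (hprim : ∀ᶠ δ in 𝓝[>] (0 : ℝ),
      IsKCPrimitive (discreteDomainGraph Ω δ) (𝓕.Λ δ) criticalBetaTwo (.fixed 1) (𝓕.B δ) (𝓕.cut δ) (𝓕.Hw δ) (𝓕.Hb δ) (𝓕.P δ))
    (hN : ∀ᶠ δ in 𝓝[>] (0 : ℝ), 0 < N δ) {M : ℝ}
    (hM : ∀ᶠ δ in 𝓝[>] (0 : ℝ), ∀ y : Site 2, r / 8 ≤ dist (meshPoint δ y) c → dist (meshPoint δ y) c ≤ r → 𝓕.Hb δ y ≤ M * N δ)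
    {s : ℕ → ℝ} (hs : Tendsto s atTop (𝓝[>] (0 : ℝ))) {hlim : ℂ → ℝ} {z : ℂ} (hz : z ∈ ball c (r / 16))
    (hconv : Tendsto (fun k => 𝓕.HwN N (s k) (nearestSite (s k) z)) atTop (𝓝 (hlim z))) :
    hlim z ≤ M := by
  have hev := hB.hb_le_near hr hcuts hprim (M := fun δ => M * N δ) hM
  have hδev : ∀ᶠ δ in 𝓝[>] (0 : ℝ), δ < r / 16 := mem_nhdsWithin_of_mem_nhds (Iio_mem_nhds (by positivity))
  have hall := hs.eventually ((hev.and (hN.and hδev)).and self_mem_nhdsWithin)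
  refine le_of_tendsto hconv ?_
  filter_upwards [hall] with k hk
  obtain ⟨⟨hk, hNk, hkδ⟩, hk0⟩ := hk
  have hk0 : (0 : ℝ) < s k := hk0
  have hd : dist (meshPoint (s k) (nearestSite (s k) z)) c < r / 8 :=
    calc dist (meshPoint (s k) (nearestSite (s k) z)) c ≤ dist (meshPoint (s k) (nearestSite (s k) z)) z + dist z c :=
          dist_triangle _ _ _
      _ < s k + r / 16 := add_lt_add_of_le_of_lt (dist_meshPoint_nearestSite_le hk0 z) (mem_ball.1 hz)
      _ < r / 8 := by linarith
  have h := (hk _ hd).2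
  rw [HwN, div_le_iff₀ hNk]
  exact h

end KCSectionFamily

end Literature.Probability.LatticeModels
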